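import Literature.AnabelianGeometry.AbsoluteAnabelian.AbsAnabProp121viiInvariantMapProofs
import Literature.AnabelianGeometry.AbsoluteAnabelian.AbsAnabProp121viiLevelCompatProofs
import Mathlib.Algebra.Colimit.Module
import HarnessLib

/-!
# The residue map at the `μ_{ℚ/ℤ}` level: `H²(G_K, μ_{ℚ/ℤ}(K̄)) := colim_n H²(G_K, μ_n) ⥲ ℚ/ℤ`

[AbsAnab] (S. Mochizuki, *The absolute anabelian geometry of hyperbolic curves*, 2004) Prop. 1.2.1 (vii)
p. 11 states the residue map on `H²(K, μ_{ℚ/ℤ}(K̄))`, `μ_{ℚ/ℤ} = colim_n μ_n` (p. 10); [AbsTopIII]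
Prop. 3.2 (i) p. 71 l.18–21, 57–60 uses «the resulting isomorphism `H²(G, μ_{ℚ/ℤ}(M_TM)) ⥲ ℚ/ℤ`» (the
composite `Prop32iChain.invariant` of `MonoidKummerMapsSub.lean`, plan rows P32.i.L01–L05) before
«applying the functor `Hom(ℚ/ℤ, −)`».  The tree types the residue map LEVEL BY LEVEL —
`Prop121vii.IsInvariantMap K n inv` (sub-DAG `plan/L4/SUBDAG-AbsAnab-Prop121vii.md` row L05, abc-iut-w5-d198),
PROVED to exist uniquely (`existsUniqueInvariantMap_holds`, abc-iut-w5-d201) and compatible along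
`μ_n ⊆ μ_N` (`invariantMap_muInclHom_compat_addCircle`, row L10, abc-iut-w5-d214).  This file GLUES
those level statements into the single printed object (constructions + proofs; no new `Prop`):

* `Prop121vii.DivLevel` — `ℕ≥1` ordered by divisibility (the index category of `colim_n`);
* `Prop121vii.invLevel K n` — THE residue map of level `n` (the unique `IsInvariantMap`);
* `Prop121vii.H2MuQZ K := colim_n H²(G_K, μ_n)` (Mathlib `AddCommGroup.DirectLimit` along
  `H²(μ_n ⊆ μ_N)`, the pattern of abc-iut-L4-t1's `muQZ`), structure maps `H2MuQZ.of`;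
* `Prop121vii.zmodToQmodZ n : ℤ/n ↪ ℚ/ℤ`, `k ↦ k/n`, and `Prop121vii.invariantQZ : H2MuQZ K →+ ℚ/ℤ`,
  the colimit of the `inv_n/n` — well defined EXACTLY by row L10;
* `Prop121vii.invariantQZEquiv : H2MuQZ K ≃+ ℚ/ℤ` — **the residue map «`H²(K, μ_{ℚ/ℤ}(K̄)) ⥲ ℚ/ℤ`» as
  one isomorphism** (injective: the level maps are; surjective: `m/n` is hit at level `n`), with
  `invariantQZEquiv_of` (value on a level-`n` class = `inv_n/n`).

`ℚ/ℤ` is Mathlib's `AddCircle (1 : ℚ)` (= `QmodZ` of `MonoidKummerMapsSub` up to `ULift`).  The comparison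
of the algebraic colimit with continuous cohomology `H²_cont(G_K, μ_∞)` is a separate (standard) step,
not made here.  HONEST FRAMING: classical local class field theory as proved in the tree; nothing here
bears on [IUTchIII] Cor. 3.12; no side taken.
-/

noncomputable section

universe u

namespace Literature.AnabelianGeometry.AbsoluteAnabelian

open Field Function
open Literature.NumberTheory.GaloisRepresentations
open Literature.NumberTheory.GaloisRepresentations.DiscreteGaloisModule

namespace Prop121vii

/-! ### The index category: positive naturals under divisibility -/

/-- `ℕ≥1` ordered by DIVISIBILITY — the index category of «`μ_{ℚ/ℤ} = colim_n μ_n`» ([AbsAnab] p.10).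
A type synonym of `ℕ+`. [cite: MochizukiAbsAnab2004, Prop 1.2.1 (vii) p.11] -/
def DivLevel : Type := ℕ+

namespace DivLevel

/-- Underlying positive natural. [cite: MochizukiAbsAnab2004, Prop 1.2.1 (vii) p.11] -/
def val (n : DivLevel) : ℕ+ := n

/-- The level of a positive natural. [cite: MochizukiAbsAnab2004, Prop 1.2.1 (vii) p.11] -/
def ofPNat (n : ℕ+) : DivLevel := n

/-- `val (ofPNat n) = n`. [cite: MochizukiAbsAnab2004, Prop 1.2.1 (vii) p.11] -/
@[simp] theorem val_ofPNat (n : ℕ+) : (ofPNat n).val = n := rfl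

/-- Divisibility preorder. [cite: MochizukiAbsAnab2004, Prop 1.2.1 (vii) p.11] -/
instance instPreorder : Preorder DivLevel where
  le a b := (a.val : ℕ) ∣ (b.val : ℕ)
  le_refl a := dvd_refl _
  le_trans _ _ _ h h' := dvd_trans h h'

/-- `a ≤ b` unfolds to `a ∣ b`. [cite: MochizukiAbsAnab2004, Prop 1.2.1 (vii) p.11] -/
theorem le_iff {a b : DivLevel} : a ≤ b ↔ (a.val : ℕ) ∣ (b.val : ℕ) := Iff.rfl

/-- Directedness: `a, b ≤ a·b`. [cite: MochizukiAbsAnab2004, Prop 1.2.1 (vii) p.11] -/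
instance instIsDirected : IsDirected DivLevel (· ≤ ·) :=
  ⟨fun a b => ⟨ofPNat (a.val * b.val), Dvd.intro _ rfl, Dvd.intro_left _ rfl⟩⟩

/-- Nonempty (level `1`). [cite: MochizukiAbsAnab2004, Prop 1.2.1 (vii) p.11] -/
instance instNonempty : Nonempty DivLevel := ⟨ofPNat 1⟩

/-- Decidable equality (from `ℕ+`). [cite: MochizukiAbsAnab2004, Prop 1.2.1 (vii) p.11] -/
instance instDecidableEq : DecidableEq DivLevel := inferInstanceAs (DecidableEq ℕ+)

/-- `NeZero` of the underlying natural (instance form used by the level typings).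
[cite: MochizukiAbsAnab2004, Prop 1.2.1 (vii) p.11] -/
instance instNeZero (n : DivLevel) : NeZero ((n.val : ℕ)) := ⟨n.val.ne_zero⟩

end DivLevel

/-! ### Finiteness of `μ_n(K̄)` and THE residue map of level `n` -/

section Level

variable (K : Type u) [Field K]

/-- `μ_n(K̄)` is finite (`n ≥ 1`): instance form of the hypothesis `[Finite (MuCarrier K n)]` carried by
the level typings (roots of unity in a field). [cite: MochizukiAbsAnab2004, Prop 1.2.1 (vii) p.11] -/
instance finite_muCarrier (n : ℕ) [NeZero n] : Finite (MuCarrier K n) :=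
  inferInstanceAs (Finite (Additive (rootsOfUnity n (AlgebraicClosure K))))

variable [ValuativeRel K] [TopologicalSpace K] [IsNonarchimedeanLocalField K] [CharZero K]

/-- **THE residue map of level `n`**: the unique `inv_n : H²(G_K, μ_n) → ℤ/n` with
`IsInvariantMap K n inv_n` (`existsUniqueInvariantMap_holds`, abc-iut-w5-d201).
[cite: MochizukiAbsAnab2004, Prop 1.2.1 (vii) p.11] -/
def invLevel (n : ℕ) [NeZero n] : galoisCohomology (mu K n) 2 →+ ZMod n :=
  (existsUniqueInvariantMap_holds K n).exists.choose

/-- `invLevel K n` IS an invariant map. [cite: MochizukiAbsAnab2004, Prop 1.2.1 (vii) p.11] -/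
theorem isInvariantMap_invLevel (n : ℕ) [NeZero n] : IsInvariantMap K n (invLevel K n) :=
  (existsUniqueInvariantMap_holds K n).exists.choose_spec

/-- Uniqueness: any invariant map of level `n` is `invLevel K n`. [cite: MochizukiAbsAnab2004, Prop 1.2.1 (vii) p.11] -/
theorem eq_invLevel {n : ℕ} [NeZero n] {inv : galoisCohomology (mu K n) 2 →+ ZMod n}
    (h : IsInvariantMap K n inv) : inv = invLevel K n :=
  (existsUniqueInvariantMap_holds K n).unique h (isInvariantMap_invLevel K n)

end Level

/-! ### `ℤ/n ↪ ℚ/ℤ`, `k ↦ k/n` -/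

/-- `k ↦ k/n : ℤ → ℚ/ℤ`. [cite: MochizukiAbsAnab2004, Prop 1.2.1 (vii) p.11] -/
def intDivToQmodZ (n : ℕ) : ℤ →+ AddCircle (1 : ℚ) where
  toFun k := (((k : ℚ) / n : ℚ) : AddCircle (1 : ℚ))
  map_zero' := by rw [Int.cast_zero, zero_div, AddCircle.coe_zero]
  map_add' a b := by rw [Int.cast_add, add_div, AddCircle.coe_add]

/-- `(1/n)ℤ/ℤ ⊆ ℚ/ℤ`: the embedding `ℤ/n → ℚ/ℤ`, `k ↦ k/n` (`n ↦ 1 = 0`).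
[cite: MochizukiAbsAnab2004, Prop 1.2.1 (vii) p.11] -/
def zmodToQmodZ (n : ℕ) [NeZero n] : ZMod n →+ AddCircle (1 : ℚ) :=
  ZMod.lift n ⟨intDivToQmodZ n, by
    change (((((n : ℤ) : ℚ)) / n : ℚ) : AddCircle (1 : ℚ)) = 0
    rw [Int.cast_natCast, div_self (Nat.cast_ne_zero.2 (NeZero.ne n)), AddCircle.coe_period]⟩

/-- `zmodToQmodZ n z = z.val / n`. [cite: MochizukiAbsAnab2004, Prop 1.2.1 (vii) p.11] -/
theorem zmodToQmodZ_apply (n : ℕ) [NeZero n] (z : ZMod n) :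
    zmodToQmodZ n z = ((((z.val : ℚ)) / n : ℚ) : AddCircle (1 : ℚ)) := by
  conv_lhs => rw [← ZMod.natCast_zmod_val z]
  rw [← Int.cast_natCast, zmodToQmodZ, ZMod.lift_coe]
  change (((((z.val : ℤ) : ℚ)) / n : ℚ) : AddCircle (1 : ℚ)) = _
  rw [Int.cast_natCast]

/-- `zmodToQmodZ n` is injective (`k/n ∈ ℤ ⇒ n ∣ k`). [cite: MochizukiAbsAnab2004, Prop 1.2.1 (vii) p.11] -/
theorem zmodToQmodZ_injective (n : ℕ) [NeZero n] : Injective (zmodToQmodZ n) := by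
  refine (injective_iff_map_eq_zero _).2 fun z hz => ?_
  rw [zmodToQmodZ_apply, AddCircle.coe_eq_zero_iff] at hz
  obtain ⟨m, hm⟩ := hz
  rw [zsmul_eq_mul, mul_one] at hm
  have hn : (n : ℚ) ≠ 0 := Nat.cast_ne_zero.2 (NeZero.ne n)
  have h : (z.val : ℤ) = m * n := by
    have : (m : ℚ) * n = z.val := by rw [hm, div_mul_cancel₀ _ hn]
    exact_mod_cast this.symm
  have hdvd : (n : ℤ) ∣ (z.val : ℤ) := ⟨m, by rw [h, mul_comm]⟩
  rw [← ZMod.natCast_zmod_val z, ZMod.natCast_eq_zero_iff]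
  exact_mod_cast hdvd

/-! ### `H²(G_K, μ_{ℚ/ℤ}(K̄)) := colim_n H²(G_K, μ_n)` -/

section Colimit

variable (K : Type u) [Field K]

/-- The direct system `n ↦ H²(G_K, μ_n(K̄))` over `ℕ≥1` ordered by divisibility, transition maps
`H²(μ_n ⊆ μ_N)` (`cohomologyMap (muInclHom K ·) 2`). [cite: MochizukiAbsAnab2004, Prop 1.2.1 (vii) p.11] -/
def H2MuSystem (i j : DivLevel) (h : i ≤ j) :
    galoisCohomology (mu K (i.val : ℕ)) 2 →+ galoisCohomology (mu K (j.val : ℕ)) 2 :=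
  (cohomologyMap (muInclHom K (DivLevel.le_iff.1 h)) 2).hom.toLinearMap.toAddMonoidHom

/-- `H2MuSystem` is the function `cohomologyMap (muInclHom K h) 2`. [cite: MochizukiAbsAnab2004, Prop 1.2.1 (vii) p.11] -/
@[simp] theorem H2MuSystem_apply (i j : DivLevel) (h : i ≤ j) (x : galoisCohomology (mu K (i.val : ℕ)) 2) :
    H2MuSystem K i j h x = cohomologyMap (muInclHom K (DivLevel.le_iff.1 h)) 2 x := rfl

/-- **`H²(G_K, μ_{ℚ/ℤ}(K̄)) := colim_n H²(G_K, μ_n(K̄))`** (Mathlib's direct limit of abelian groups over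
`ℕ≥1` ordered by divisibility). [cite: MochizukiAbsAnab2004, Prop 1.2.1 (vii) p.11] -/
def H2MuQZ : Type u :=
  AddCommGroup.DirectLimit (fun n : DivLevel => galoisCohomology (mu K (n.val : ℕ)) 2) (H2MuSystem K)

/-- `H²(G_K, μ_{ℚ/ℤ})` is an abelian group. [cite: MochizukiAbsAnab2004, Prop 1.2.1 (vii) p.11] -/
instance H2MuQZ.instAddCommGroup : AddCommGroup (H2MuQZ K) := by
  unfold H2MuQZ
  infer_instance

variable {K}

/-- The structure map `H²(G_K, μ_n) → H²(G_K, μ_{ℚ/ℤ})` of level `n : ℕ+`.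
[cite: MochizukiAbsAnab2004, Prop 1.2.1 (vii) p.11] -/
def H2MuQZ.of (n : ℕ+) : galoisCohomology (mu K (n : ℕ)) 2 →+ H2MuQZ K :=
  AddCommGroup.DirectLimit.of (fun m : DivLevel => galoisCohomology (mu K (m.val : ℕ)) 2) (H2MuSystem K)
    (DivLevel.ofPNat n)

/-- Compatibility of the structure maps with `H²(μ_n ⊆ μ_N)` (`n ∣ N`).
[cite: MochizukiAbsAnab2004, Prop 1.2.1 (vii) p.11] -/
theorem H2MuQZ.of_cohomologyMap {n N : ℕ+} (h : (n : ℕ) ∣ (N : ℕ)) (x : galoisCohomology (mu K (n : ℕ)) 2) :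
    H2MuQZ.of N (cohomologyMap (muInclHom K h) 2 x) = H2MuQZ.of n x :=
  AddCommGroup.DirectLimit.of_f (G := fun m : DivLevel => galoisCohomology (mu K (m.val : ℕ)) 2)
    (f := H2MuSystem K) (i := DivLevel.ofPNat n) (j := DivLevel.ofPNat N) h x

/-- Every class of `H²(G_K, μ_{ℚ/ℤ})` comes from some level `n`. [cite: MochizukiAbsAnab2004, Prop 1.2.1 (vii) p.11] -/
theorem H2MuQZ.exists_of (z : H2MuQZ K) : ∃ (n : ℕ+) (x : galoisCohomology (mu K (n : ℕ)) 2), H2MuQZ.of n x = z := by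
  induction z using AddCommGroup.DirectLimit.induction_on with
  | ih i x => exact ⟨i.val, x, rfl⟩

variable (K)
variable [ValuativeRel K] [TopologicalSpace K] [IsNonarchimedeanLocalField K] [CharZero K]

/-- **The residue map at the `μ_{ℚ/ℤ}` level**, `H²(G_K, μ_{ℚ/ℤ}) → ℚ/ℤ`: the colimit of the level
residue maps read in `(1/n)ℤ/ℤ ⊆ ℚ/ℤ` — well defined by the level compatibility (row L10,
`invariantMap_muInclHom_compat_addCircle`). [cite: MochizukiAbsAnab2004, Prop 1.2.1 (vii) p.11] -/
def invariantQZ : H2MuQZ K →+ AddCircle (1 : ℚ) :=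
  AddCommGroup.DirectLimit.lift (fun m : DivLevel => galoisCohomology (mu K (m.val : ℕ)) 2) (H2MuSystem K)
    (AddCircle (1 : ℚ)) (fun m => (zmodToQmodZ (m.val : ℕ)).comp (invLevel K (m.val : ℕ)))
    (fun i j hij x => by
      rw [AddMonoidHom.comp_apply, AddMonoidHom.comp_apply, zmodToQmodZ_apply, zmodToQmodZ_apply,
        H2MuSystem_apply]
      exact invariantMap_muInclHom_compat_addCircle K (DivLevel.le_iff.1 hij) (invLevel K _)
        (invLevel K _) (isInvariantMap_invLevel K _) (isInvariantMap_invLevel K _) x)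

variable {K}

/-- Value of `invariantQZ` on a level-`n` class, through `zmodToQmodZ`. [cite: MochizukiAbsAnab2004, Prop 1.2.1 (vii) p.11] -/
theorem invariantQZ_of' (n : ℕ+) (x : galoisCohomology (mu K (n : ℕ)) 2) :
    invariantQZ K (H2MuQZ.of n x) = zmodToQmodZ (n : ℕ) (invLevel K (n : ℕ) x) :=
  AddCommGroup.DirectLimit.lift_of (G := fun m : DivLevel => galoisCohomology (mu K (m.val : ℕ)) 2)
    (f := H2MuSystem K) _ _ _ (DivLevel.ofPNat n) x

/-- Value of `invariantQZ` on a level-`n` class: `inv_n(x)/n`. [cite: MochizukiAbsAnab2004, Prop 1.2.1 (vii) p.11] -/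
theorem invariantQZ_of (n : ℕ+) (x : galoisCohomology (mu K (n : ℕ)) 2) :
    invariantQZ K (H2MuQZ.of n x) = (((((invLevel K (n : ℕ) x).val : ℚ)) / (n : ℕ) : ℚ) : AddCircle (1 : ℚ)) := by
  rw [invariantQZ_of', zmodToQmodZ_apply]

/-- `invariantQZ` is injective. [cite: MochizukiAbsAnab2004, Prop 1.2.1 (vii) p.11] -/
theorem invariantQZ_injective : Injective (invariantQZ K) := by
  refine (injective_iff_map_eq_zero _).2 fun z hz => ?_
  obtain ⟨n, x, rfl⟩ := H2MuQZ.exists_of z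
  rw [invariantQZ_of'] at hz
  have hx : invLevel K (n : ℕ) x = 0 := zmodToQmodZ_injective _ (by rw [hz, map_zero])
  have hx0 : x = 0 := (isInvariantMap_invLevel K (n : ℕ)).1.1 (by rw [hx, map_zero])
  rw [hx0, map_zero]

/-- `invariantQZ` is surjective: `m/n` is the residue of `inv_n⁻¹(m)`. [cite: MochizukiAbsAnab2004, Prop 1.2.1 (vii) p.11] -/
theorem invariantQZ_surjective : Surjective (invariantQZ K) := by
  intro u
  obtain ⟨N, hN⟩ : ∃ N : ℕ, 0 < N ∧ N • u = 0 := by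
    induction u using QuotientAddGroup.induction_on with
    | H q =>
      refine ⟨q.den, q.pos, ?_⟩
      have h := AddCircle.addOrderOf_coe_rat (p := (1 : ℚ)) (q := q)
      rw [Rat.cast_id, mul_one] at h
      rw [← h]
      exact addOrderOf_nsmul_eq_zero _
  obtain ⟨hNpos, hNu⟩ := hN
  obtain ⟨m, hm, rfl⟩ := (AddCircle.nsmul_eq_zero_iff hNpos).1 hNu
  haveI : NeZero N := ⟨hNpos.ne'⟩
  obtain ⟨x, hx⟩ := (isInvariantMap_invLevel K N).1.2 (m : ZMod N)
  refine ⟨H2MuQZ.of ⟨N, hNpos⟩ x, ?_⟩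
  rw [invariantQZ_of, mul_one]
  change (((((invLevel K N x).val : ℚ)) / N : ℚ) : AddCircle (1 : ℚ)) = _
  rw [hx, ZMod.val_natCast_of_lt hm]

variable (K)

/-- **«`H²(K, μ_{ℚ/ℤ}(K̄)) ⥲ ℚ/ℤ`», the residue map at the `μ_{ℚ/ℤ}` level as ONE isomorphism**
([AbsAnab] Prop 1.2.1 (vii); = [AbsTopIII] Prop 3.2 (i) «the resulting isomorphism
`H²(G, μ_{ℚ/ℤ}(M_TM)) ⥲ ℚ/ℤ`» for the model pair, where `M^gp_TM = k̄ˣ`). CONSTRUCTED.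
[cite: MochizukiAbsAnab2004, Prop 1.2.1 (vii) p.11] -/
def invariantQZEquiv : H2MuQZ K ≃+ AddCircle (1 : ℚ) :=
  AddEquiv.ofBijective (invariantQZ K) ⟨invariantQZ_injective, invariantQZ_surjective⟩

variable {K}

/-- Value of the residue isomorphism on a level-`n` class. [cite: MochizukiAbsAnab2004, Prop 1.2.1 (vii) p.11] -/
theorem invariantQZEquiv_of (n : ℕ+) (x : galoisCohomology (mu K (n : ℕ)) 2) :
    invariantQZEquiv K (H2MuQZ.of n x) =
      (((((invLevel K (n : ℕ) x).val : ℚ)) / (n : ℕ) : ℚ) : AddCircle (1 : ℚ)) :=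
  invariantQZ_of n x

end Colimit

end Prop121vii

end Literature.AnabelianGeometry.AbsoluteAnabelian

end
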